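import Mathlib
import Summits.ResolutionOfSingularities.ResolutionOfSingularities.Theorems.HomologicalConductorPersistenceStaircaseRecords
import HarnessLib

/-!
# Rung S-2 `PersistenceSurface` (stmt-19970), stub C1 (`Sat₄`) — the INFINITE FAMILY `1/n(1,n−2)`, `n` odd:
# `ca(k[u,v]^{μ_n(1,n−2)}) = ca⁴ = ⋂_{c even} s̲ann(M_c)`, with `(n−1)/2` cospecial pieces, kernel-certified
# UNIFORMLY in `n` (chain W4.4b; T-V package, part 26; seat leafhand-res-homologicalconduct-10 gen 2)

[OURS · L1 w44b · rung S-2] Nothing here is a statement of the manuscript under review (Hironaka 2017);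
AI-written, weaker than expert review.

Part 25 (`…CyclicQuotientOneTwo`) certified the family `1/n(1,2)` (`e = 2`).  This file runs the same gen-6 pipeline
(isotypic splitting → record staircases → Ω-stable distinguished family →
`…CyclicQuotientIsotypic.cohomologyAnnihilator_eq_four_of_isotypicData`) on the family at the OTHER end of the
Riemenschneider table: `U = k[u,v]^{μ_n(1,n−2)}` for every odd `n = 2b + 1 ≥ 3` (`ζ` a primitive `n`-th root of
unity, `n ∈ kˣ`).  Here `n/(n−2) = [2, 2, …, 2, 3]` has length `e = b = (n−1)/2` — UNBOUNDED in `n` — with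
`i`-series `(n−2, n−4, …, 3, 1)`, so the cospecial pieces are ALL the even classes `M_2, M_4, …, M_{n−1}`, and the
distinguished family of the certificate is indexed by `Fin ((n−1)/2)`.  Since `−(n−2) ≡ 2`, the orbit `j ↦ a + 2j`
of a class `a` with `a.val = α` has a record staircase of length `≤ 2` and is PARAMETRIC:

* `α` odd: generators `u^{α}`, `v^{(n−α)/2}` — one drop `α`, `Ω M_a ≅ M_{n−α}`;
* `α ≥ 2` even: generators `u^{α}`, `u v^{(n−α+1)/2}`, `v^{n−α/2}` — drops `α − 1, 1`, `Ω M_a ≅ M_{n+1−α} ⊕ M_{n−1}`;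
* the family of even classes is Ω-stable: `M_{2(t+1)} | Ω M_{n−1−2t}` (position `0`), for every `t < b`;
* **`cohomologyAnnihilator_one_nMinusTwo`** — for every odd `n ≥ 3`: `ca(U) = ca⁴(U)` and
  `x ∈ ca(U) ↔ x ∈ ⋂_{t < (n−1)/2} s̲ann(M_{2(t+1)})`.

`U` is Gorenstein only for `n = 3` (`A₂`); for `n ≥ 5` these are non-Gorenstein rational stages of the `Sat₄`
residual (`SaturationFourSurfaceResidual₄`, class (iii) of the hand censuses).  All side conditions are linear in
`(α, n, s, i)` up to the single product `(n − 2)·j`, removed once by `natCast_sub_two_mul`; no `decide`, no table.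

References: folklore (Auslander 1986 / Herzog 1978 mechanism; Wunram 1988, Riemenschneider 1974 for the classical
names); res-L1-w44b-idea-1 SC-TORIC v2 (OURS, memo).
-/

-- single-problem summit: the doubled namespace component `ResolutionOfSingularities` is forced
set_option linter.dupNamespace false

noncomputable section

open CategoryTheory Literature.RingTheory.CohomologyAnnihilator MvPolynomial
open Summit.ResolutionOfSingularities.ResolutionOfSingularities.Theorems.NoZeno.SandwichCluster
open Summit.ResolutionOfSingularities.ResolutionOfSingularities.Theorems.HomologicalConductor.PersistenceAddCoverFamily
open Summit.ResolutionOfSingularities.ResolutionOfSingularities.Theorems.HomologicalConductor.PersistenceCyclicQuotientIsotypic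
open Summit.ResolutionOfSingularities.ResolutionOfSingularities.Theorems.HomologicalConductor.PersistenceCyclicQuotientIsotypicPieces
open Summit.ResolutionOfSingularities.ResolutionOfSingularities.Theorems.HomologicalConductor.PersistenceStaircaseRecords

universe u

namespace Summit.ResolutionOfSingularities.ResolutionOfSingularities.Theorems.HomologicalConductor.PersistenceCyclicQuotientNMinusTwo

/-! ## Casts into `ZMod n`: the wrap-around identities used by the staircase -/

/-- Naturals adding up to a multiple of `n` give opposite classes: `x + y = m n ⇒ (y : ZMod n) = −x`. [folklore] -/
theorem natCast_eq_neg_of_add_eq_mul {n x y m : ℕ} (h : x + y = m * n) :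
    ((y : ℕ) : ZMod n) = -((x : ℕ) : ZMod n) := by
  have h' := congrArg (Nat.cast : ℕ → ZMod n) h
  rw [Nat.cast_add, Nat.cast_mul, ZMod.natCast_self, mul_zero] at h'
  linear_combination h'

/-- `x + m·n = y + a.val ⇒ (x : ZMod n) − y = a`. [folklore] -/
theorem natCast_sub_natCast_eq {n : ℕ} [NeZero n] (a : ZMod n) {x y m : ℕ} (h : x + m * n = y + a.val) :
    ((x : ℕ) : ZMod n) - ((y : ℕ) : ZMod n) = a := by
  have h' := congrArg (Nat.cast : ℕ → ZMod n) h
  rw [Nat.cast_add, Nat.cast_add, Nat.cast_mul, ZMod.natCast_self, mul_zero, add_zero,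
    ZMod.natCast_zmod_val] at h'
  linear_combination h'

/-- The weight `q = n − 2` acts as `−2`: `(c + (n−2) j : ZMod n) = c − 2j` (`n ≥ 2`). [folklore] -/
theorem natCast_sub_two_mul {n : ℕ} (hn : 2 ≤ n) (c j : ℕ) :
    ((c + (n - 2) * j : ℕ) : ZMod n) = ((c : ℕ) : ZMod n) - ((2 * j : ℕ) : ZMod n) := by
  have h : (n - 2) * j + 2 * j = n * j := by rw [← Nat.add_mul, Nat.sub_add_cancel hn]
  have h' := congrArg (Nat.cast : ℕ → ZMod n) h
  rw [Nat.cast_add, Nat.cast_mul n, ZMod.natCast_self, zero_mul] at h'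
  rw [Nat.cast_add]
  linear_combination h'

/-- The value of `a + 2i` is `(a.val + 2i) mod n`. [folklore] -/
theorem val_add_two_mul {n : ℕ} [NeZero n] (a : ZMod n) (i : ℕ) :
    (a + ((2 * i : ℕ) : ZMod n)).val = (a.val + 2 * i) % n := by
  have h : a + ((2 * i : ℕ) : ZMod n) = ((a.val + 2 * i : ℕ) : ZMod n) := by
    rw [Nat.cast_add, ZMod.natCast_zmod_val]
  rw [h, ZMod.val_natCast]

/-! ## The certificate -/

variable {k : Type u} [Field k] {n : ℕ} [NeZero n] {ζ : k} (hζ : IsPrimitiveRoot ζ n) (hn : (n : k) ≠ 0)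
variable (U : Subalgebra k (MvPolynomial (Fin 2) k))
variable (hU : ∀ p, p ∈ U ↔ aeval (fun i : Fin 2 => C (ζ ^ (![1, n - 2] : Fin 2 → ℕ) i) * X i) p = p)

set_option maxHeartbeats 1600000 in
set_option synthInstance.maxHeartbeats 400000 in
include hζ hn hU in
/-- **`Sat₄` and the exact centre for `k[u,v]^{μ_n(1,n−2)}`, every odd `n ≥ 3`, kernel-certified uniformly in `n`.**
With the weight pieces `M a = {p | σ₀ p = ζ^a p}` (`σ₀ : u ↦ ζu, v ↦ ζ^{n−2}v`): `ca(U) = ca⁴(U)` and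
`x ∈ ca(U) ↔ x` stably annihilates every even piece `M_{2(t+1)}`, `t < (n−1)/2` (the duals of the specials
`M_{n−2}, M_{n−4}, …, M_1`; `i`-series of `n/(n−2) = [2,…,2,3]`).  For `n ≥ 5` these stages are non-Gorenstein and
the number of cospecial pieces, `(n−1)/2`, is unbounded.  (Budgets raised locally as in parts 21–25.)
[OURS · L1 w44b] -/
theorem cohomologyAnnihilator_one_nMinusTwo (hodd : Odd n) (hn3 : 3 ≤ n) :
    ∃ M : ZMod n → Submodule U ((restrictScalarsFunctor U (MvPolynomial (Fin 2) k)).obj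
        (ModuleCat.of (MvPolynomial (Fin 2) k) (MvPolynomial (Fin 2) k))),
      (∀ (a : ZMod n) (p : MvPolynomial (Fin 2) k),
        (show ((restrictScalarsFunctor U (MvPolynomial (Fin 2) k)).obj
          (ModuleCat.of (MvPolynomial (Fin 2) k) (MvPolynomial (Fin 2) k))) from p) ∈ M a ↔
        aeval (fun i : Fin 2 => C (ζ ^ (![1, n - 2] : Fin 2 → ℕ) i) * X i) p = C (ζ ^ a.val) * p) ∧
      cohomologyAnnihilator U = cohomologyAnnihilatorOfDegree U 4 ∧
      ∀ x : U, x ∈ cohomologyAnnihilator U ↔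
        ∀ t : Fin (n / 2), StablyAnnihilates U x
          (@ModuleCat.of U _ (M (((2 * ((t : ℕ) + 1) : ℕ) : ZMod n))) _
            (M (((2 * ((t : ℕ) + 1) : ℕ) : ZMod n))).module) := by
  classical
  have hq : Nat.Coprime (n - 2) n :=
    (Nat.coprime_self_sub_left (by omega)).mpr (Nat.coprime_two_left.mpr hodd)
  obtain ⟨M, hM, ⟨e⟩⟩ := exists_isotypic_splitting hζ hn hq U hU
  obtain ⟨b, hb⟩ := hodd
  have hval : ∀ a : ZMod n, a.val < n := fun a => ZMod.val_lt a
  -- per-class staircase data, `α = a.val`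
  let μ : ZMod n → ℕ := fun a => if a.val = 0 then 0 else 2 - a.val % 2
  let j₁ : ZMod n → ℕ := fun a => if a.val % 2 = 1 then (n - a.val) / 2 else (n - a.val + 1) / 2
  let J : ZMod n → ℕ := fun a => if a.val % 2 = 1 then (n - a.val) / 2 else n - a.val / 2
  let J' : ZMod n → ℕ := fun a => if a.val = 0 then 0 else J a
  let c : ZMod n → ℕ → ℕ := fun a s =>
    if s = 0 then a.val else if s = 1 then (if a.val % 2 = 0 then (if a.val = 0 then 0 else 1) else 0) else 0
  let j : ZMod n → ℕ → ℕ := fun a s =>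
    if a.val = 0 then 0 else if s = 0 then 0 else if s = 1 then j₁ a else J a
  let d : ZMod n → ℕ → ZMod n := fun a t => if t = 0 then -(((a.val - (1 - a.val % 2) : ℕ) : ZMod n)) else -1
  have hc_anti : ∀ a, Antitone (c a) := by
    intro a s t hst
    dsimp only [c]
    split_ifs <;> (first | contradiction | omega)
  have hj_mono : ∀ a, Monotone (j a) := by
    intro a s t hst
    have := hval a
    dsimp only [j, j₁, J]
    split_ifs <;> (first | contradiction | omega)
  -- the class of every generator
  have hcl : ∀ a s, ((c a s + (n - 2) * j a s : ℕ) : ZMod n) = a := by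
    intro a s
    have hlt := hval a
    rw [natCast_sub_two_mul (by omega)]
    by_cases h0 : a.val = 0
    · have hc : c a s = 0 := by dsimp only [c]; split_ifs <;> (first | contradiction | omega)
      have hj : j a s = 0 := by dsimp only [j]; rw [if_pos h0]
      rw [hc, hj, mul_zero, Nat.cast_zero, sub_zero]
      exact ((ZMod.val_eq_zero a).mp h0).symm
    · by_cases hs0 : s = 0
      · have hc : c a s = a.val := by dsimp only [c]; rw [if_pos hs0]
        have hj : j a s = 0 := by dsimp only [j]; rw [if_neg h0, if_pos hs0]
        rw [hc, hj, mul_zero, Nat.cast_zero, sub_zero, ZMod.natCast_zmod_val]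
      · by_cases hρ : a.val % 2 = 1
        · have hc : c a s = 0 := by dsimp only [c]; split_ifs <;> (first | contradiction | omega)
          have hj : j a s = (n - a.val) / 2 := by dsimp only [j, j₁, J]; split_ifs <;> (first | contradiction | omega)
          rw [hc, hj]
          exact natCast_sub_natCast_eq a (m := 1) (by omega)
        · by_cases hs1 : s = 1
          · have hc : c a s = 1 := by dsimp only [c]; split_ifs <;> (first | contradiction | omega)
            have hj : j a s = (n - a.val + 1) / 2 := by dsimp only [j, j₁, J]; (split_ifs; first | contradiction | omega)
            rw [hc, hj]
            exact natCast_sub_natCast_eq a (m := 1) (by omega)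
          · have hc : c a s = 0 := by dsimp only [c]; (split_ifs; first | contradiction | omega)
            have hj : j a s = n - a.val / 2 := by dsimp only [j, j₁, J]; (split_ifs; first | contradiction | omega)
            rw [hc, hj]
            exact natCast_sub_natCast_eq a (m := 2) (by omega)
  -- the drop classes: `−α` (odd `α`); `−(α−1)` then `−1` (even `α ≥ 2`)
  have hψ : ∀ a t, t < μ a → d a t = a - ((c a t + (n - 2) * j a (t + 1) : ℕ) : ZMod n) := by
    intro a t ht
    have hlt := hval a
    rw [natCast_sub_two_mul (by omega)]
    dsimp only [μ] at ht
    have h0 : a.val ≠ 0 := by intro h0; rw [if_pos h0] at ht; exact Nat.not_lt_zero _ ht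
    rw [if_neg h0] at ht
    by_cases ht0 : t = 0
    · have hc : c a t = a.val := by dsimp only [c]; rw [if_pos ht0]
      by_cases hρ : a.val % 2 = 1
      · have hd : d a t = -((a.val : ℕ) : ZMod n) := by
          dsimp only [d]; rw [if_pos ht0, show a.val - (1 - a.val % 2) = a.val by omega]
        have hj : j a (t + 1) = (n - a.val) / 2 := by dsimp only [j, j₁, J]; split_ifs <;> (first | contradiction | omega)
        rw [hd, hc, hj, natCast_eq_neg_of_add_eq_mul (x := a.val) (y := 2 * ((n - a.val) / 2)) (m := 1) (by omega),
          ZMod.natCast_zmod_val]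
        ring
      · have hd : d a t = -((a.val - 1 : ℕ) : ZMod n) := by
          dsimp only [d]; rw [if_pos ht0, show a.val - (1 - a.val % 2) = a.val - 1 by omega]
        have hj : j a (t + 1) = (n - a.val + 1) / 2 := by dsimp only [j, j₁, J]; split_ifs <;> (first | contradiction | omega)
        rw [hd, hc, hj,
          natCast_eq_neg_of_add_eq_mul (x := a.val - 1) (y := 2 * ((n - a.val + 1) / 2)) (m := 1) (by omega),
          ZMod.natCast_zmod_val]
        ring
    · have ht1 : t = 1 := by omega
      have hd : d a t = -1 := by dsimp only [d]; rw [if_neg ht0]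
      have hc : c a t = 1 := by dsimp only [c]; split_ifs <;> (first | contradiction | omega)
      have hj : j a (t + 1) = n - a.val / 2 := by dsimp only [j, j₁, J]; split_ifs <;> (first | contradiction | omega)
      rw [hd, hc, hj, Nat.cast_one,
        natCast_eq_neg_of_add_eq_mul (x := a.val) (y := 2 * (n - a.val / 2)) (m := 2) (by omega), ZMod.natCast_zmod_val]
      ring
  -- `q J' ≡ a`
  have hJ : ∀ a, (((n - 2) * J' a : ℕ) : ZMod n) = a := by
    intro a
    have hlt := hval a
    have h := natCast_sub_two_mul (n := n) (by omega) 0 (J' a)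
    rw [zero_add, Nat.cast_zero, zero_sub] at h
    rw [h]
    by_cases h0 : a.val = 0
    · have hJv : J' a = 0 := by dsimp only [J']; rw [if_pos h0]
      rw [hJv, mul_zero, Nat.cast_zero, neg_zero]
      exact ((ZMod.val_eq_zero a).mp h0).symm
    · by_cases hρ : a.val % 2 = 1
      · have hJv : J' a = (n - a.val) / 2 := by dsimp only [J', J]; (split_ifs; first | contradiction | omega)
        rw [hJv, natCast_eq_neg_of_add_eq_mul (x := a.val) (y := 2 * ((n - a.val) / 2)) (m := 1) (by omega), neg_neg,
          ZMod.natCast_zmod_val]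
      · have hJv : J' a = n - a.val / 2 := by dsimp only [J', J]; (split_ifs; first | contradiction | omega)
        rw [hJv, natCast_eq_neg_of_add_eq_mul (x := a.val) (y := 2 * (n - a.val / 2)) (m := 2) (by omega), neg_neg,
          ZMod.natCast_zmod_val]
  -- the cover property on `[0, J']`
  have hcov : ∀ a i, i ≤ J' a →
      ∃ s, s ≤ μ a ∧ j a s ≤ i ∧ c a s ≤ ((a - (((n - 2) * i : ℕ) : ZMod n) : ZMod n)).val := by
    intro a i hi
    have hlt := hval a
    have h := natCast_sub_two_mul (n := n) (by omega) 0 i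
    rw [zero_add, Nat.cast_zero, zero_sub] at h
    rw [h, sub_neg_eq_add, val_add_two_mul]
    have hc0 : c a 0 = a.val := by dsimp only [c]; rw [if_pos rfl]
    by_cases h0 : a.val = 0
    · have hj0 : j a 0 = 0 := by dsimp only [j]; rw [if_pos h0]
      refine ⟨0, Nat.zero_le _, ?_, ?_⟩
      · rw [hj0]; exact Nat.zero_le _
      · rw [hc0, h0]; exact Nat.zero_le _
    · have hμ : μ a = 2 - a.val % 2 := by dsimp only [μ]; rw [if_neg h0]
      have hj0 : j a 0 = 0 := by dsimp only [j]; rw [if_neg h0, if_pos rfl]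
      by_cases hlow : a.val + 2 * i < n
      · refine ⟨0, Nat.zero_le _, ?_, ?_⟩
        · rw [hj0]; exact Nat.zero_le _
        · rw [hc0, Nat.mod_eq_of_lt hlow]; omega
      · by_cases hρ : a.val % 2 = 1
        · have hJv : J' a = (n - a.val) / 2 := by dsimp only [J', J]; (split_ifs; first | contradiction | omega)
          rw [hJv] at hi
          have hc1 : c a 1 = 0 := by dsimp only [c]; split_ifs <;> (first | contradiction | omega)
          have hj1 : j a 1 = (n - a.val) / 2 := by dsimp only [j, j₁]; split_ifs <;> (first | contradiction | omega)
          refine ⟨1, by rw [hμ]; omega, ?_, ?_⟩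
          · rw [hj1]; omega
          · rw [hc1]; exact Nat.zero_le _
        · have hJv : J' a = n - a.val / 2 := by dsimp only [J', J]; (split_ifs; first | contradiction | omega)
          rw [hJv] at hi
          by_cases hiJ : i < n - a.val / 2
          · have hc1 : c a 1 = 1 := by dsimp only [c]; split_ifs <;> (first | contradiction | omega)
            have hj1 : j a 1 = (n - a.val + 1) / 2 := by dsimp only [j, j₁]; split_ifs <;> (first | contradiction | omega)
            refine ⟨1, by rw [hμ]; omega, ?_, ?_⟩
            · rw [hj1]; omega
            · rw [hc1, Nat.mod_eq_sub_mod (by omega), Nat.mod_eq_of_lt (by omega)]; omega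
          · have hc2 : c a 2 = 0 := by dsimp only [c]; split_ifs <;> (first | contradiction | omega)
            have hj2 : j a 2 = n - a.val / 2 := by dsimp only [j, j₁, J]; split_ifs <;> (first | contradiction | omega)
            refine ⟨2, by rw [hμ]; omega, ?_, ?_⟩
            · rw [hj2]; omega
            · rw [hc2]; exact Nat.zero_le _
  -- the staircase resolutions `Ω M_a ≅ Π_{t < μ a} M (d a t)`
  let M' : ZMod n → ModuleCat.{u} U := fun a => @ModuleCat.of U _ (M a) _ (M a).module
  let K : ZMod n → ModuleCat.{u} U := fun a => ModuleCat.of U (Π t : Fin (μ a), M (d a t))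
  have hK : ∀ a, IsSyzygy 1 (M' a) (K a) := by
    intro a
    refine isSyzygy_one_staircase_of_lt hζ U hU M hM a (μ a) (c a) (j a) (hc_anti a) (hj_mono a) (hcl a)
      (d a) (hψ a) ?_
    exact isotypic_le_span_of_cover hζ U hU M hM a (μ a) (J' a) (c a) (j a) (hcl a) (hJ a) (hcov a)
  -- the certificate data: distinguished family = the even classes `2(t+1)`, `t < (n−1)/2`
  let ψ' : Fin (n / 2) → ZMod n := fun t => (((2 * ((t : ℕ) + 1) : ℕ) : ZMod n))
  have hψ'val : ∀ t : Fin (n / 2), (ψ' t).val = 2 * ((t : ℕ) + 1) := by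
    intro t
    have := t.isLt
    exact ZMod.val_natCast_of_lt (by omega)
  have hdψ : ∀ a t, t < μ a → ∃ s : Fin (n / 2), d a t = ψ' s := by
    intro a t ht
    have hlt := hval a
    dsimp only [μ] at ht
    have h0 : a.val ≠ 0 := by intro h0; rw [if_pos h0] at ht; exact Nat.not_lt_zero _ ht
    rw [if_neg h0] at ht
    by_cases ht0 : t = 0
    · by_cases hρ : a.val % 2 = 1
      · -- `α` odd: `−α = n − α = 2(s+1)` with `s = (n − α)/2 − 1`
        have hd : d a t = -((a.val : ℕ) : ZMod n) := by
          dsimp only [d]; rw [if_pos ht0, show a.val - (1 - a.val % 2) = a.val by omega]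
        refine ⟨⟨(n - a.val) / 2 - 1, by omega⟩, ?_⟩
        rw [hd]
        exact (natCast_eq_neg_of_add_eq_mul (x := a.val) (y := 2 * ((n - a.val) / 2 - 1 + 1)) (m := 1)
          (by omega)).symm
      · -- `α` even: `−(α − 1) = n + 1 − α = 2(s+1)` with `s = (n − α + 1)/2 − 1`
        have hd : d a t = -((a.val - 1 : ℕ) : ZMod n) := by
          dsimp only [d]; rw [if_pos ht0, show a.val - (1 - a.val % 2) = a.val - 1 by omega]
        refine ⟨⟨(n - a.val + 1) / 2 - 1, by omega⟩, ?_⟩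
        rw [hd]
        exact (natCast_eq_neg_of_add_eq_mul (x := a.val - 1) (y := 2 * ((n - a.val + 1) / 2 - 1 + 1)) (m := 1)
          (by omega)).symm
    · -- the last drop `1`: `−1 = n − 1 = 2(s+1)` with `s = (n−1)/2 − 1`
      have hd : d a t = -((1 : ℕ) : ZMod n) := by dsimp only [d]; rw [if_neg ht0, Nat.cast_one]
      refine ⟨⟨n / 2 - 1, by omega⟩, ?_⟩
      rw [hd]
      exact (natCast_eq_neg_of_add_eq_mul (x := 1) (y := 2 * (n / 2 - 1 + 1)) (m := 1) (by omega)).symm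
  have hfin : ∀ t, Module.Finite U (M' (ψ' t)) := fun t => finite_isotypic hζ (n - 2) U hU M hM _
  have hKD : ∀ a, IsRetractOfPower (ModuleCat.of U ((Π t, M' (ψ' t)) × U)) (K a) := by
    intro a
    refine IsRetractOfPower.piFamily (fun t : Fin (μ a) => M' (d a t)) fun t => ?_
    obtain ⟨s, heq⟩ := hdψ a t t.isLt
    exact (isRetractOfPower_fst (ModuleCat.of U (Π t, M' (ψ' t))) (ModuleCat.of U U)).of_isRetractOfPower_gen
      ((isRetractOfPower_eval (fun t : Fin (n / 2) => M' (ψ' t)) s).of_iso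
        (LinearEquiv.toModuleIso (LinearEquiv.ofEq _ _ (by rw [heq]))))
  have hD : ∀ t, ∃ (s : Fin (n / 2)) (i : M' (ψ' t) ⟶ K (ψ' s)) (r : K (ψ' s) ⟶ M' (ψ' t)),
      i ≫ r = 𝟙 (M' (ψ' t)) := by
    -- `M_{2(t+1)} | Ω M_{n−1−2t}` at position `0`: the source is the even class `2((n−1)/2 − t) = ψ' ((n−1)/2 − 1 − t)`
    have hsrc : ∀ t : Fin (n / 2), ∃ (s : Fin (n / 2)) (p : Fin (μ (ψ' s))), d (ψ' s) p = ψ' t := by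
      intro t
      have ht := t.isLt
      let s : Fin (n / 2) := ⟨n / 2 - 1 - t, by omega⟩
      have hsval : (ψ' s).val = 2 * (n / 2 - 1 - t + 1) := hψ'val s
      have hμs : μ (ψ' s) = 2 := by
        dsimp only [μ]
        rw [hsval, if_neg (by omega)]
        omega
      refine ⟨s, ⟨0, by rw [hμs]; exact Nat.zero_lt_two⟩, ?_⟩
      have hd : d (ψ' s) ((⟨0, by rw [hμs]; exact Nat.zero_lt_two⟩ : Fin (μ (ψ' s))) : ℕ) =
          -((n - 2 - 2 * (t : ℕ) : ℕ) : ZMod n) := by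
        dsimp only [d]
        rw [if_pos rfl, hsval, show 2 * (n / 2 - 1 - (t : ℕ) + 1) - (1 - 2 * (n / 2 - 1 - (t : ℕ) + 1) % 2) =
          n - 2 - 2 * (t : ℕ) by omega]
      rw [hd]
      exact (natCast_eq_neg_of_add_eq_mul (x := n - 2 - 2 * (t : ℕ)) (y := 2 * ((t : ℕ) + 1)) (m := 1)
        (by omega)).symm
    intro t
    obtain ⟨s, p, hp⟩ := hsrc t
    let E : M (d (ψ' s) p) ≃ₗ[U] M (ψ' t) := LinearEquiv.ofEq _ _ (by rw [hp])
    refine ⟨s,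
      @ModuleCat.ofHom U _ (M (ψ' t)) (Π t' : Fin (μ (ψ' s)), M (d (ψ' s) t'))
        _ (M (ψ' t)).module _ _
        ((LinearMap.single U (fun t' : Fin (μ (ψ' s)) => M (d (ψ' s) t')) p) ∘ₗ E.symm.toLinearMap),
      @ModuleCat.ofHom U _ (Π t' : Fin (μ (ψ' s)), M (d (ψ' s) t')) (M (ψ' t))
        _ _ _ (M (ψ' t)).module (E.toLinearMap ∘ₗ LinearMap.proj p), ?_⟩
    apply ModuleCat.hom_ext
    refine LinearMap.ext fun x => ?_
    change E ((Pi.single p (E.symm x) : Π t' : Fin (μ (ψ' s)), M (d (ψ' s) t')) p) = x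
    rw [Pi.single_eq_same, LinearEquiv.apply_symm_apply]
  obtain ⟨h4, hiff⟩ := @cohomologyAnnihilator_eq_four_of_isotypicData k _ n _ ζ hζ hn (n - 2) hq U hU
    (Fin (n / 2)) _ M' e K hK ψ' hfin hKD hD
  exact ⟨M, hM, h4, hiff⟩

end Summit.ResolutionOfSingularities.ResolutionOfSingularities.Theorems.HomologicalConductor.PersistenceCyclicQuotientNMinusTwo

end
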